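import Literature.NumberTheory.EllipticCurves.IwasawaAlgebraTwoVarGeneratorChange
import HarnessLib

/-!
# Pair transport for two-variable Iwasawa duals, Ia: ideals `(T₁^N, T₂^N)` of `Λ₂ = ℤ_p⟦T₂⟧⟦T₁⟧`, truncation,
# and the frame substitution `IwasawaAlgebra₂.frameSubstRingHom ℤ_p M` moves `T₁, T₂` inside `(T₁, T₂)` (THEOREMS only)

Cell `bsd-2adic`, seat `bsd-2adic-tower-1` GEN 49, SUMMON key «PAIR-TRANSPORT₂» (pen `bsd-2adic-plan` g35, director-bsd
(552)(C)(W1)): piece P3 `SplitPrimeLineFiniteTwo.TorsionResidueTransportAt` of the O2 node (stmt-BirchSwinnertonDyer-24728,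
line of record v7, stub `stub_torsionResidueTransport`).  THEOREMS ONLY (no definition, no named fact, no instance, no
`sorry`); pure `ℤ_p`-algebra, nothing about elliptic curves or BSD is claimed.

THE POINT.  The tree's two-variable dual `X_Gr₂ = Hom(H¹_{nr,v̄}(K̃_∞, E[p^∞]), ℚ/ℤ)` (`WeierstrassCurve.XGr₂`) is a
`Λ₂`-module through `IwasawaDual.IsLocNil₂.module₂` at the pair `(conj_{γ₁} − 1, conj_{γ₂} − 1)` of a topological generator
pair `(γ₁, γ₂)` of `Gal(K̃_∞/K) ≅ ℤ_p²`; a second generator pair `(γ₁', γ₂')` with `γ_j' = γ₁^{M 0 j} γ₂^{M 1 j}`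
(`p`-adic exponents, `M ∈ M₂(ℤ_p)`) gives a second structure on THE SAME group.  This file proves, for an abstract
`p`-primary group `S` with commuting endomorphisms `g₁, g₂` and a second pair `g₁', g₂'` which is, ELEMENTWISE and
`p`-ADICALLY, a monomial in `g₁, g₂` (hypothesis `hlink`: on each `s` fixed by `g₁^{p^m}, g₂^{p^m}`, `g_j' s =
g₂^{n₂} g₁^{n₁} s` for all natural lifts `(n₁, n₂)` of column `j` of `M` modulo `p^m`), that the two actions differ
by the frame substitution `φ_M : 1 + T_j ↦ (1+T₁)^{M 0 j} (1+T₂)^{M 1 j}` of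
`Literature/…/IwasawaAlgebraTwoVarGeneratorChange.lean`:

  `hB.smulFun₂ F x = hA.smulFun₂ (frameSubstRingHom ℤ_p M F) x`   (`smulFun₂_eq_smulFun₂_frameSubstRingHom`,
in the sequel `…PairTransportAlgebra.lean`).

THIS FILE (the ring-theoretic half of the density argument): §1 membership in `(T₁^N, T₂^N)` from vanishing low
coefficients (`mem_span_X_pow_CX_pow_of_coeff`), truncation `F − Σ_{i,j<N} [T₁^iT₂^j]F · T₁^iT₂^j ∈ (T₁^N, T₂^N)`
(`sub_trunc₂_mem_span`), `(T₁,T₂)^{2N} ⊆ (T₁^N, T₂^N)`; §2 `φ_M(T₁), φ_M(T₂) ∈ (T₁, T₂)` (constant-constant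
coefficient `1·1 − 1 = 0`), hence `φ_M((T₁^{2N}, T₂^{2N})) ⊆ (T₁^N, T₂^N)` (`frameSubstRingHom_mem_span_of_mem_span`).

References: S. Lang, *Cyclotomic Fields I–II*, GTM 121, Ch. 5 §1 (the action of `Λ` through its finite quotients)
[Lang1990]; Neukirch–Schmidt–Wingberg (5.3.5) (`𝒪⟦ℤ_p²⟧ ≅ 𝒪⟦T₁,T₂⟧`, change of basis) [NeukirchSchmidtWingberg2008];
R. Greenberg, LNM 1716 §1 p. 60 [GreenbergLNM1716]; K. Rubin, Invent. Math. 103 (1991) §4 p. 36 [Rubin1991].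
-/

noncomputable section

set_option linter.dupNamespace false
set_option autoImplicit false

open scoped Classical
open PowerSeries Finset
open Literature.NumberTheory.EllipticCurves

namespace Summit.BirchSwinnertonDyer.BirchSwinnertonDyer.Theorems.TwoAdicBDPPairTransport

/-! ## §1 Ideals `(T₁^N, T₂^N)` of the nested ring `R⟦T₂⟧⟦T₁⟧` -/

section Ideals

variable {R : Type*} [CommRing R]

/-- **Membership in `(T₁^N, T₂^N)` from vanishing of the low coefficients**: if `[T₁^i T₂^j] G = 0` for all
`i, j < N` then `G ∈ (T₁^N, T₂^N)` (split off `T₁^N ·(high part)`, the rest has every `T₁^i`-coefficient divisible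
by `T₂^N`). [cite: Lang1990, Ch. 5 §1] -/
theorem mem_span_X_pow_CX_pow_of_coeff {N : ℕ} {G : PowerSeries (PowerSeries R)}
    (hG : ∀ i < N, ∀ j < N, coeff j (coeff i G) = 0) :
    G ∈ Ideal.span {(X : PowerSeries (PowerSeries R)) ^ N, (C X) ^ N} := by
  set Gh : PowerSeries (PowerSeries R) := PowerSeries.mk fun i ↦ coeff (i + N) G with hGh
  set Gl : PowerSeries (PowerSeries R) := G - X ^ N * Gh with hGl
  have hGl_coeff : ∀ i, ∀ j < N, coeff j (coeff i Gl) = 0 := by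
    intro i j hj
    rw [hGl, map_sub, PowerSeries.coeff_X_pow_mul']
    split_ifs with hNi
    · rw [hGh, PowerSeries.coeff_mk, Nat.sub_add_cancel hNi, sub_self, map_zero]
    · rw [sub_zero]
      exact hG i (lt_of_not_ge hNi) j hj
  have hdvd : ∀ i, (X : PowerSeries R) ^ N ∣ coeff i Gl := fun i ↦
    PowerSeries.X_pow_dvd_iff.mpr fun j hj ↦ hGl_coeff i j hj
  choose h hh using hdvd
  have hGl_eq : Gl = (C X) ^ N * PowerSeries.mk h := by
    ext i
    rw [← map_pow, PowerSeries.coeff_C_mul, PowerSeries.coeff_mk, ← hh i]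
  rw [Ideal.mem_span_pair]
  refine ⟨Gh, PowerSeries.mk h, ?_⟩
  have e : G = X ^ N * Gh + Gl := by rw [hGl]; abel
  rw [e, hGl_eq]
  ring

/-- Coefficients of the monomial `c T₁^a T₂^b` in the nested ring. [folklore] -/
theorem coeff_monomial₂ (c : R) (a b i : ℕ) :
    coeff i (C (C c) * (X : PowerSeries (PowerSeries R)) ^ a * (C X) ^ b) =
      if i = a then C c * X ^ b else 0 := by
  rw [mul_assoc, mul_comm (X ^ a), ← mul_assoc, ← map_pow, ← map_mul, PowerSeries.coeff_C_mul_X_pow]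

/-- **Truncation modulo `(T₁^N, T₂^N)`**: `F` minus its bidegree-`< (N, N)` part
`Σ_{i,j<N} C (C [T₁^i T₂^j]F) · T₁^i T₂^j` lies in `(T₁^N, T₂^N)`. [cite: Lang1990, Ch. 5 §1] -/
theorem sub_trunc₂_mem_span (F : PowerSeries (PowerSeries R)) (N : ℕ) :
    F - ∑ i ∈ range N, ∑ j ∈ range N, C (C (coeff j (coeff i F))) * X ^ i * (C X) ^ j ∈
      Ideal.span {(X : PowerSeries (PowerSeries R)) ^ N, (C X) ^ N} := by
  apply mem_span_X_pow_CX_pow_of_coeff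
  intro i hi j hj
  rw [map_sub, map_sub, map_sum, map_sum, Finset.sum_eq_single_of_mem i (Finset.mem_range.mpr hi), map_sum,
    map_sum, Finset.sum_eq_single_of_mem j (Finset.mem_range.mpr hj)]
  · rw [coeff_monomial₂, if_pos rfl, PowerSeries.coeff_C_mul_X_pow, if_pos rfl, sub_self]
  · intro b _ hb
    rw [coeff_monomial₂, if_pos rfl, PowerSeries.coeff_C_mul_X_pow, if_neg (Ne.symm hb)]
  · intro a _ ha
    rw [map_sum, map_sum]
    exact Finset.sum_eq_zero fun b _ ↦ by rw [coeff_monomial₂, if_neg (Ne.symm ha), map_zero]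

/-- `(T₁, T₂)^{N+N} ⊆ (T₁^N, T₂^N)`: an element of `(T₁, T₂)` has its `(N+N)`-th power in `(T₁^N, T₂^N)`.
[cite: Lang1990, Ch. 5 §1] -/
theorem pow_mem_span_of_mem_span_X_CX {u : PowerSeries (PowerSeries R)}
    (hu : u ∈ Ideal.span {(X : PowerSeries (PowerSeries R)), C X}) (N : ℕ) :
    u ^ (N + N) ∈ Ideal.span {(X : PowerSeries (PowerSeries R)) ^ N, (C X) ^ N} := by
  rw [Ideal.span_insert] at hu ⊢
  have h1 : u ^ (N + N) ∈ (Ideal.span {(X : PowerSeries (PowerSeries R))} ⊔ Ideal.span {C X}) ^ (N + N) :=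
    Ideal.pow_mem_pow hu _
  have h2 := Ideal.sup_pow_add_le_pow_sup_pow h1
  rwa [Ideal.span_singleton_pow, Ideal.span_singleton_pow] at h2

/-- **Membership in `(T₁, T₂)`** from the vanishing of the constant-constant coefficient. [cite: Lang1990, Ch. 5 §1] -/
theorem mem_span_X_CX_of_coeff {G : PowerSeries (PowerSeries R)} (hG : coeff 0 (coeff 0 G) = 0) :
    G ∈ Ideal.span {(X : PowerSeries (PowerSeries R)), C X} := by
  have h := mem_span_X_pow_CX_pow_of_coeff (N := 1) (G := G) (fun i hi j hj ↦ by
    rw [Nat.lt_one_iff] at hi hj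
    subst hi; subst hj
    exact hG)
  rwa [pow_one, pow_one] at h

end Ideals

/-! ## §2 The frame substitution moves `T₁`, `T₂` inside `(T₁, T₂)` -/

section Frame

variable {p : ℕ} [Fact p.Prime]

/-- `φ_M(T₁) = (1+T₁)^a (1+T₂)^c − 1`. [cite: NeukirchSchmidtWingberg2008, (5.3.5)] -/
theorem frameSubstRingHom_X (M : Matrix (Fin 2) (Fin 2) ℤ_[p]) :
    IwasawaAlgebra₂.frameSubstRingHom ℤ_[p] M X =
      PowerSeries.map (C (R := ℤ_[p])) (PowerSeries.binomialSeries ℤ_[p] (M 0 0)) *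
        C (PowerSeries.binomialSeries ℤ_[p] (M 1 0)) - 1 := by
  rw [← IwasawaAlgebra₂.frameSubstRingHom_one_add_X, map_add, map_one, add_sub_cancel_left]

/-- `φ_M(T₂) = (1+T₁)^b (1+T₂)^d − 1`. [cite: NeukirchSchmidtWingberg2008, (5.3.5)] -/
theorem frameSubstRingHom_C_X (M : Matrix (Fin 2) (Fin 2) ℤ_[p]) :
    IwasawaAlgebra₂.frameSubstRingHom ℤ_[p] M (C X) =
      PowerSeries.map (C (R := ℤ_[p])) (PowerSeries.binomialSeries ℤ_[p] (M 0 1)) *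
        C (PowerSeries.binomialSeries ℤ_[p] (M 1 1)) - 1 := by
  rw [← IwasawaAlgebra₂.frameSubstRingHom_one_add_C_X, map_add, map_one, add_sub_cancel_left]

/-- `(1+T₁)^x (1+T₂)^y − 1 ∈ (T₁, T₂)` (its constant-constant coefficient is `1·1 − 1 = 0`).
[cite: NeukirchSchmidtWingberg2008, (5.3.5)] -/
theorem binomial_mul_binomial_sub_one_mem_span (x y : ℤ_[p]) :
    PowerSeries.map (C (R := ℤ_[p])) (PowerSeries.binomialSeries ℤ_[p] x) *
        C (PowerSeries.binomialSeries ℤ_[p] y) - 1 ∈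
      Ideal.span {(X : PowerSeries (PowerSeries ℤ_[p])), C X} := by
  apply mem_span_X_CX_of_coeff
  have hx : PowerSeries.constantCoeff (PowerSeries.binomialSeries ℤ_[p] x) = 1 :=
    PowerSeries.binomialSeries_constantCoeff x
  have hy : PowerSeries.constantCoeff (PowerSeries.binomialSeries ℤ_[p] y) = 1 :=
    PowerSeries.binomialSeries_constantCoeff y
  have h1 : PowerSeries.constantCoeff
      (PowerSeries.map (C (R := ℤ_[p])) (PowerSeries.binomialSeries ℤ_[p] x)) = 1 := by
    rw [← PowerSeries.coeff_zero_eq_constantCoeff_apply, PowerSeries.coeff_map,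
      PowerSeries.coeff_zero_eq_constantCoeff_apply, hx, map_one]
  simp only [PowerSeries.coeff_zero_eq_constantCoeff_apply, map_sub, map_mul, map_one, PowerSeries.constantCoeff_C,
    h1, hy, one_mul, sub_self]

/-- `φ_M(T₁) ∈ (T₁, T₂)`. [cite: NeukirchSchmidtWingberg2008, (5.3.5)] -/
theorem frameSubstRingHom_X_mem_span (M : Matrix (Fin 2) (Fin 2) ℤ_[p]) :
    IwasawaAlgebra₂.frameSubstRingHom ℤ_[p] M X ∈ Ideal.span {(X : PowerSeries (PowerSeries ℤ_[p])), C X} := by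
  rw [frameSubstRingHom_X]
  exact binomial_mul_binomial_sub_one_mem_span _ _

/-- `φ_M(T₂) ∈ (T₁, T₂)`. [cite: NeukirchSchmidtWingberg2008, (5.3.5)] -/
theorem frameSubstRingHom_C_X_mem_span (M : Matrix (Fin 2) (Fin 2) ℤ_[p]) :
    IwasawaAlgebra₂.frameSubstRingHom ℤ_[p] M (C X) ∈ Ideal.span {(X : PowerSeries (PowerSeries ℤ_[p])), C X} := by
  rw [frameSubstRingHom_C_X]
  exact binomial_mul_binomial_sub_one_mem_span _ _

/-- **`φ_M((T₁^{N+N}, T₂^{N+N})) ⊆ (T₁^N, T₂^N)`** (continuity of the frame substitution for the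
`(T₁, T₂)`-adic topology, in the finite form used below). [cite: NeukirchSchmidtWingberg2008, (5.3.5)] -/
theorem frameSubstRingHom_mem_span_of_mem_span (M : Matrix (Fin 2) (Fin 2) ℤ_[p]) {N : ℕ}
    {G : PowerSeries (PowerSeries ℤ_[p])}
    (hG : G ∈ Ideal.span {(X : PowerSeries (PowerSeries ℤ_[p])) ^ (N + N), (C X) ^ (N + N)}) :
    IwasawaAlgebra₂.frameSubstRingHom ℤ_[p] M G ∈
      Ideal.span {(X : PowerSeries (PowerSeries ℤ_[p])) ^ N, (C X) ^ N} := by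
  obtain ⟨a, b, rfl⟩ := Ideal.mem_span_pair.mp hG
  rw [map_add, map_mul, map_mul, map_pow, map_pow]
  exact Ideal.add_mem _
    (Ideal.mul_mem_left _ _ (pow_mem_span_of_mem_span_X_CX (frameSubstRingHom_X_mem_span M) N))
    (Ideal.mul_mem_left _ _ (pow_mem_span_of_mem_span_X_CX (frameSubstRingHom_C_X_mem_span M) N))

end Frame

end Summit.BirchSwinnertonDyer.BirchSwinnertonDyer.Theorems.TwoAdicBDPPairTransport

end
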